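import Mathlib
import Summits.SmoothPoincare4.SmoothPoincare4.Theorems.HyperbolicEnd.Negative.NeckDensity
import Summits.SmoothPoincare4.SmoothPoincare4.Theorems.HyperbolicEnd.Negative.NeckCertificate
import Summits.SmoothPoincare4.SmoothPoincare4.Theorems.HyperbolicEnd.Negative.NeckNotFillable

/-!
# `HyperbolicEnd` (stmt-SmoothPoincare4-7825), line `Sketch`, negative side — frozen-`J` certificate filling is false in complex dimension one

Line `Sketch` (idea `hyperbolic-crumpling`) reduces the crux `HyperbolicEnd` to two stubs, the
second of which is the flat, `Σ`-free **certificate ball-filling** statement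
`stub_certificateFill` on `ℝ⁴ = ℂ²`: a certificate `(J, F, c)` on a shell
`r₁ < ‖x - a‖ < r₃` (along every local `J`-holomorphic curve `g` the density
`λ = F(g, ∂ₓ g)` is `C²` with `2c λ³ ≤ λ Δλ - |∇λ|²`, i.e. Gauss curvature `≤ -c`) whose `J` extends
over the ball can be filled by a certificate `(J', F', c')` on the whole ball agreeing with
`(J, F)` on the outer shell `r₂ < ‖x - a‖ < r₃`; the filling may change the almost complex
structure inside (`J'` free on `‖x - a‖ ≤ r₂`).

This file records, kernel-checked, that **the freedom in `J'` is essential**: the verbatim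
complex-dimension-one transcription of the filling statement with the almost complex structure
FROZEN (`J = J' =` multiplication by `I`, the only translation-invariant choice in dimension one)
is FALSE (`helper_frozenFillDim1_false`).  The counterexample is the *neck*
`F(x, v) = (1 + 81/‖x‖⁴)‖v‖²` on the shell `1 < ‖x‖ < 4` (certified with `c = 10⁻³`:
`helper_neckDensity`, `helper_neckCertificate`): in the logarithmic chart `x = eʷ` its density
`e^{2s} + 81 e^{-2s}` (`s = re w`) has a closed geodesic at `‖x‖ = 3`, and a disc bounded by a
closed geodesic cannot carry curvature `≤ -c' < 0` (Gauss–Bonnet).  The formal proof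
(`helper_neckNotFillable`, file `Negative/NeckNotFillable.lean`) replaces Gauss–Bonnet by an
elementary maximum principle: the Schwarz-type growth bound `F'(x, v) ≤ 16‖v‖²/(c'(4 - ‖x‖)²)`
for any certified filling (`helper_lineGrowth`, from the disc line test `helper_discLineTest`),
the flat-weight test (`helper_expWeightTest`: `λ e^{-s}` has no interior maximum for a certified
`λ > 0`), `2πi`-periodicity of the pulled-back density, and the three values `Q = 6` on
`s = log 3`, `Q > 6` at `s = log 2.9`, `Q < 6` far to the left, of `Q = λ e^{-s}`.

**Reading for the line.** In dimension one the obstruction is Gauss–Bonnet: negative flux of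
`log λ` through a circle enclosing the hole (for a radial density `μ(r)|dz|²` one has
`∮ k_g = 2π(1 + r ∂ᵣ log √μ)`, so a negatively curved filling of the disc `‖x‖ ≤ r` needs
`∂ᵣ μ(r) > 0` at every matching radius, and the neck decreases); allowing `J'` to vary does not
help there (every `J'` on a disc is integrable and uniformised).  The same mechanism transplants
to `ℂ²` with the integrable frozen `J = i`: a certified conformally flat shell germ
`e^{2ψ}‖v‖²` with `ψ` plurisubharmonic on the shell and of negative flux along one complex line
through the hole exists (toric averaging only forces monotone circle means along lines that
MISS the hole; lead notes, cycle 4, give an explicit `ψ`).  So the genuinely open content of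
`stub_certificateFill` is the rotation of `J'` on `‖x - a‖ ≤ r₂`: a filling must destroy every
low-genus `J'`-holomorphic cap of the bad circles, and no filling invariant of certified germs is
known.
-/

noncomputable section

-- the prescribed namespace `Summit.<P>.<Sub>.…` duplicates `SmoothPoincare4` (P = Sub)
set_option linter.dupNamespace false

open scoped ContDiff Topology Real
open Laplacian Set Filter Metric Complex

namespace Summit.SmoothPoincare4.SmoothPoincare4.Theorems.HyperbolicEnd.Negative

/-- The neck density `F(x, v) = (1 + 81/‖x‖⁴)‖v‖²` is smooth on `(shell) × ℂ` for the shell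
`1 < ‖x‖ < 4` (indeed off `x = 0`). -/
private theorem neck_contDiffOn :
    ContDiffOn ℝ ∞ (fun y : ℂ × ℂ => (1 + 81 / (‖y.1‖ ^ 2) ^ 2) * ‖y.2‖ ^ 2)
      ((Metric.ball (0 : ℂ) 4 \ Metric.closedBall (0 : ℂ) 1) ×ˢ Set.univ) := by
  have h1 : ContDiffOn ℝ ∞ (fun y : ℂ × ℂ => (1 + 81 / (‖y.1‖ ^ 2) ^ 2 : ℝ))
      ((Metric.ball (0 : ℂ) 4 \ Metric.closedBall (0 : ℂ) 1) ×ˢ Set.univ) := by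
    refine helper_neckDensity.1.comp contDiff_fst.contDiffOn ?_
    intro y hy
    have hy1 : ¬ ‖y.1‖ ≤ 1 := by
      have := hy.1.2
      simpa [Metric.mem_closedBall, dist_zero_right] using this
    have hpos : 0 < ‖y.1‖ := lt_of_lt_of_le one_pos (le_of_lt (lt_of_not_ge hy1))
    exact norm_pos_iff.1 hpos
  have h2 : ContDiffOn ℝ ∞ (fun y : ℂ × ℂ => ‖y.2‖ ^ 2)
      ((Metric.ball (0 : ℂ) 4 \ Metric.closedBall (0 : ℂ) 1) ×ˢ Set.univ) :=
    ((contDiff_norm_sq ℝ).comp contDiff_snd).contDiffOn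
  exact h1.mul h2

/-- The neck density is positive definite on the shell (in fact everywhere off `x = 0`). -/
private theorem neck_posDef :
    ∀ x ∈ Metric.ball (0 : ℂ) 4 \ Metric.closedBall (0 : ℂ) 1, ∀ v : ℂ,
      0 ≤ (1 + 81 / (‖x‖ ^ 2) ^ 2) * ‖v‖ ^ 2 ∧ ((1 + 81 / (‖x‖ ^ 2) ^ 2) * ‖v‖ ^ 2 = 0 → v = 0) := by
  intro x _ v
  have hc : 0 < 1 + 81 / (‖x‖ ^ 2) ^ 2 := by positivity
  refine ⟨by positivity, fun h => ?_⟩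
  have hv : ‖v‖ ^ 2 = 0 := by
    rcases mul_eq_zero.1 h with h' | h'
    · exact absurd h' hc.ne'
    · exact h'
  exact norm_eq_zero.1 (pow_eq_zero_iff two_ne_zero |>.1 hv)

/-- The neck `(i, F, 10⁻³)` is a certificate on the shell `1 < ‖x‖ < 4` in the exact format of
the filling statement: along every local holomorphic `g : U → shell` the density
`F(g w)(∂ₓ g w)` is `C²` and satisfies the curvature inequality (`helper_neckCertificate`, with
`C^∞` weakened to `C²`). -/
private theorem neck_certificate :
    ∀ (U : Set ℂ) (g : ℂ → ℂ), IsOpen U → ContDiffOn ℝ ∞ g U →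
      (∀ z ∈ U, ∀ ζ : ℂ, fderiv ℝ g z (Complex.I * ζ) = Complex.I * fderiv ℝ g z ζ) →
      (∀ z ∈ U, g z ∈ Metric.ball (0 : ℂ) 4 \ Metric.closedBall (0 : ℂ) 1) →
      ContDiffOn ℝ 2 (fun w => ((1 + 81 / (‖g w‖ ^ 2) ^ 2) * ‖fderiv ℝ g w 1‖ ^ 2 : ℝ)) U ∧
        ∀ z ∈ U, 2 * (1 / 1000) * ((1 + 81 / (‖g z‖ ^ 2) ^ 2) * ‖fderiv ℝ g z 1‖ ^ 2) ^ 3 ≤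
          (1 + 81 / (‖g z‖ ^ 2) ^ 2) * ‖fderiv ℝ g z 1‖ ^ 2 *
              (Δ (fun w => ((1 + 81 / (‖g w‖ ^ 2) ^ 2) * ‖fderiv ℝ g w 1‖ ^ 2 : ℝ))) z -
            ((fderiv ℝ (fun w => ((1 + 81 / (‖g w‖ ^ 2) ^ 2) * ‖fderiv ℝ g w 1‖ ^ 2 : ℝ)) z 1) ^ 2 +
              (fderiv ℝ (fun w => ((1 + 81 / (‖g w‖ ^ 2) ^ 2) * ‖fderiv ℝ g w 1‖ ^ 2 : ℝ)) z
                Complex.I) ^ 2) := by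
  intro U g hU hg hhol hmem
  have hann : ∀ z ∈ U, 1 < ‖g z‖ ∧ ‖g z‖ < 4 := by
    intro z hz
    obtain ⟨hb, hc⟩ := hmem z hz
    refine ⟨?_, by simpa [Metric.mem_ball, dist_zero_right] using hb⟩
    have : ¬ ‖g z‖ ≤ 1 := by simpa [Metric.mem_closedBall, dist_zero_right] using hc
    exact lt_of_not_ge this
  obtain ⟨h1, h2⟩ := helper_neckCertificate U g hU hg hhol hann
  exact ⟨h1.of_le (by norm_cast), h2⟩

/-- lead c3 (negative side of line `Sketch`): **frozen-`J` certificate filling is false in complex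
dimension one.**  The verbatim one-dimensional transcription of the flat filling stub
`stub_certificateFill` with the almost complex structure frozen to multiplication by `I` on both
sides fails: the neck `F(x,v) = (1 + 81/‖x‖⁴)‖v‖²`, `a = 0`, `r₁ = 1`, `r₂ = 2`, `r₃ = 4`,
`c = 10⁻³` satisfies all hypotheses (`neck_contDiffOn`, `neck_posDef`, `neck_certificate`) and
admits no certified filling (`helper_neckNotFillable`). -/
theorem helper_frozenFillDim1_false : ¬ (∀ (F : ℂ → ℂ → ℝ) (a : ℂ) (r₁ r₂ r₃ c : ℝ), 0 < r₁ → r₁ < r₂ → r₂ < r₃ → 0 < c → ContDiffOn ℝ ∞ (fun y : ℂ × ℂ => F y.1 y.2) ((Metric.ball a r₃ \ Metric.closedBall a r₁) ×ˢ Set.univ) → (∀ x ∈ Metric.ball a r₃ \ Metric.closedBall a r₁, ∀ v : ℂ, 0 ≤ F x v ∧ (F x v = 0 → v = 0)) → (∀ (U : Set ℂ) (g : ℂ → ℂ), IsOpen U → ContDiffOn ℝ ∞ g U → (∀ z ∈ U, ∀ ζ : ℂ, fderiv ℝ g z (Complex.I * ζ) = Complex.I * fderiv ℝ g z ζ) →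 (∀ z ∈ U, g z ∈ Metric.ball a r₃ \ Metric.closedBall a r₁) → ContDiffOn ℝ 2 (fun w => F (g w) (fderiv ℝ g w 1)) U ∧ ∀ z ∈ U, 2 * c * (F (g z) (fderiv ℝ g z 1)) ^ 3 ≤ F (g z) (fderiv ℝ g z 1) * (Δ (fun w => F (g w) (fderiv ℝ g w 1))) z - ((fderiv ℝ (fun w => F (g w) (fderiv ℝ g w 1)) z 1) ^ 2 + (fderiv ℝ (fun w => F (g w) (fderiv ℝ g w 1)) z Complex.I) ^ 2)) → ∃ (F' : ℂ → ℂ → ℝ) (c' : ℝ), 0 < c' ∧ (∀ x ∈ Metric.ball a r₃ \ Metric.closedBall a r₂, ∀ v : ℂ, F' x v = F x v) ∧ (∀ x ∈ Metric.ball a r₃, ∀ v : ℂ, 0 ≤ F' x v ∧ (F' x v = 0 → v = 0)) ∧ (∀ (U : Set ℂ) (g : ℂ → ℂ), IsOpen U → ContDiffOn ℝ ∞ g U → (∀ z ∈ U, ∀ ζ : ℂ, fderiv ℝ g z (Complex.I * ζ) = Complex.I * fderiv ℝ g z ζ) → (∀ z ∈ U, g z ∈ Metric.ball a r₃) → ContDiffOn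 ℝ 2 (fun w => F' (g w) (fderiv ℝ g w 1)) U ∧ ∀ z ∈ U, 2 * c' * (F' (g z) (fderiv ℝ g z 1)) ^ 3 ≤ F' (g z) (fderiv ℝ g z 1) * (Δ (fun w => F' (g w) (fderiv ℝ g w 1))) z - ((fderiv ℝ (fun w => F' (g w) (fderiv ℝ g w 1)) z 1) ^ 2 + (fderiv ℝ (fun w => F' (g w) (fderiv ℝ g w 1)) z Complex.I) ^ 2))) := by
  intro h
  obtain ⟨F', c', hc', hagree, hpos', hcert'⟩ :=
    h (fun x v => (1 + 81 / (‖x‖ ^ 2) ^ 2) * ‖v‖ ^ 2) 0 1 2 4 (1 / 1000) one_pos (by norm_num)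
      (by norm_num) (by norm_num) neck_contDiffOn neck_posDef neck_certificate
  exact helper_neckNotFillable F' c' hc' hagree hpos' hcert'

end Summit.SmoothPoincare4.SmoothPoincare4.Theorems.HyperbolicEnd.Negative

end
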